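import Mathlib.MeasureTheory.Integral.Marginal
import Mathlib.MeasureTheory.Integral.Bochner.Basic
import Mathlib.MeasureTheory.Group.LIntegral

/-!
# Line `beta-slope-floor` (crux `IR`, stmt-QuantumFields-19354): two symmetries of product Haar measure

Route `BalabanLadder`, crux `IR`, line `beta-slope-floor` (registered stub `stub_rung_strongCoupling`), lead
prover `ym-ir-line-bsf-p1`.  Group-blind measure theory on a finite product `ι → G` of copies of a left-invariant
σ-finite measure `μ` (for the rung: the product Haar measure of the DOUBLED torus link configuration):

* §1 `measurePreserving_comp_equiv` — relabelling the coordinates by a bijection `e : ι ≃ ι` preserves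
  `Measure.pi (fun _ => μ)` (Mathlib's `measurePreserving_piCongrLeft`, unbundled).  In the rung this is the
  SLAB SWAP exchanging the two copies of every link in a time slab.
* §2 `lintegral_comp_update_mul`, `measurePreserving_update_mul` — the SKEW LEFT TRANSLATION
  `W ↦ update W ℓ (c W · W ℓ)` of ONE coordinate by a group element `c W` that does not read that coordinate
  preserves the product measure (peel the `ℓ`-integral with `lmarginal_erase'`, then left invariance of `μ`).
  In the rung this re-aligns the one action factor that straddles the slab boundary.

Honest framing: plumbing; nothing here bears on the Yang–Mills mass gap (Clay).  R4 of the ladder closes only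
the conditional finite-𝕋⁴ rung `BalabanLadder.UV`.
Refs: folklore (Fubini and invariance of Haar measure); line card `Cruxes/IR/Lines/beta-slope-floor.md`.
-/

set_option autoImplicit false

noncomputable section

open MeasureTheory Function
open scoped ENNReal

namespace Summit.QuantumFields.YangMills.Cruxes.IR.BetaSlopeFloor

section PiSymmetry

variable {ι : Type*} [Fintype ι] {G : Type*} [MeasurableSpace G]
  (μ : Measure G) [SigmaFinite μ]

/-! ## §1 Relabelling coordinates -/

/-- **Relabelling coordinates preserves the product measure**: for a bijection `e` of the index set,
`W ↦ W ∘ e` maps `μ^{⊗ι}` to itself. -/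
theorem measurePreserving_comp_equiv (e : ι ≃ ι) :
    MeasurePreserving (fun W : ι → G => fun i => W (e i)) (Measure.pi fun _ : ι => μ)
      (Measure.pi fun _ : ι => μ) := by
  have h := measurePreserving_piCongrLeft (fun _ : ι => μ) e.symm
  refine ⟨?_, ?_⟩
  · exact measurable_pi_iff.2 fun i => measurable_pi_apply (e i)
  · have hfun : (fun W : ι → G => fun i => W (e i)) =
        ⇑(MeasurableEquiv.piCongrLeft (fun _ : ι => G) e.symm) := by
      funext W i
      simp [MeasurableEquiv.piCongrLeft, Equiv.piCongrLeft_apply_eq_cast]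
    rw [hfun]
    exact h.map_eq

/-! ## §2 Skew left translation of one coordinate -/

variable [DecidableEq ι] [Group G] [MeasurableMul₂ G] [Measure.IsMulLeftInvariant μ]

omit [Fintype ι] [Measure.IsMulLeftInvariant μ] in
/-- The skew left translation of the coordinate `ℓ` is measurable. -/
theorem measurable_update_mul (ℓ : ι) {c : (ι → G) → G} (hc : Measurable c) :
    Measurable fun x : ι → G => update x ℓ (c x * x ℓ) :=
  measurable_update'.comp (measurable_id.prodMk (hc.mul (measurable_pi_apply ℓ)))

/-- **Skew left translation of one coordinate preserves all product integrals.**  If `c : (ι → G) → G` is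
measurable and does not read the coordinate `ℓ`, then for every measurable `f ≥ 0`,
`∫ f (update x ℓ (c x · x ℓ)) dμ^{⊗ι}(x) = ∫ f dμ^{⊗ι}`: peel off the `ℓ`-integral (Fubini for the finite
product), observe that on the fibre the map is the left translation by the constant `c x`, and use left
invariance of `μ`. -/
theorem lintegral_comp_update_mul (ℓ : ι) {c : (ι → G) → G} (hc : Measurable c)
    (hcℓ : ∀ x g, c (update x ℓ g) = c x) {f : (ι → G) → ℝ≥0∞} (hf : Measurable f) :
    ∫⁻ x, f (update x ℓ (c x * x ℓ)) ∂(Measure.pi fun _ : ι => μ) =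
      ∫⁻ x, f x ∂(Measure.pi fun _ : ι => μ) := by
  have hΦ := measurable_update_mul ℓ hc
  have h1 := lintegral_eq_lmarginal_univ (μ := fun _ : ι => μ) (f := f ∘ fun x => update x ℓ (c x * x ℓ))
    (fun _ => 1)
  have h2 := lintegral_eq_lmarginal_univ (μ := fun _ : ι => μ) (f := f) (fun _ => 1)
  simp only [Function.comp_apply] at h1
  rw [h1, h2, lmarginal_erase' _ (hf.comp hΦ) (Finset.mem_univ ℓ),
    lmarginal_erase' _ hf (Finset.mem_univ ℓ)]
  congr 1
  funext x
  simp only [Function.comp_apply, update_idem, update_self, hcℓ]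
  exact lintegral_mul_left_eq_self (fun g => f (update x ℓ g)) (c x)

/-- **Skew left translation of one coordinate preserves the product measure.** -/
theorem measurePreserving_update_mul (ℓ : ι) {c : (ι → G) → G} (hc : Measurable c)
    (hcℓ : ∀ x g, c (update x ℓ g) = c x) :
    MeasurePreserving (fun x : ι → G => update x ℓ (c x * x ℓ)) (Measure.pi fun _ : ι => μ)
      (Measure.pi fun _ : ι => μ) := by
  have hΦ := measurable_update_mul ℓ hc
  refine ⟨hΦ, Measure.ext fun s hs => ?_⟩
  rw [Measure.map_apply hΦ hs, ← lintegral_indicator_one (hΦ hs), ← lintegral_indicator_one hs]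
  have : (fun x : ι → G => ((fun x : ι → G => update x ℓ (c x * x ℓ)) ⁻¹' s).indicator
      (1 : (ι → G) → ℝ≥0∞) x) =
      fun x => s.indicator (1 : (ι → G) → ℝ≥0∞) (update x ℓ (c x * x ℓ)) := by
    funext x
    rfl
  rw [this]
  exact lintegral_comp_update_mul μ ℓ hc hcℓ (measurable_one.indicator hs)

/-- Integrals of real functions are invariant under the skew left translation of one coordinate. -/
theorem integral_comp_update_mul (ℓ : ι) {c : (ι → G) → G} (hc : Measurable c)
    (hcℓ : ∀ x g, c (update x ℓ g) = c x) {f : (ι → G) → ℝ} (hf : Measurable f) :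
    ∫ x, f (update x ℓ (c x * x ℓ)) ∂(Measure.pi fun _ : ι => μ) =
      ∫ x, f x ∂(Measure.pi fun _ : ι => μ) := by
  have h := measurePreserving_update_mul μ ℓ hc hcℓ
  rw [← h.map_eq, integral_map h.measurable.aemeasurable hf.aestronglyMeasurable, h.map_eq]

omit [DecidableEq ι] [Group G] [MeasurableMul₂ G] [Measure.IsMulLeftInvariant μ] in
/-- Integrals of real functions are invariant under relabelling the coordinates. -/
theorem integral_comp_equiv (e : ι ≃ ι) {f : (ι → G) → ℝ} (hf : Measurable f) :
    ∫ W, f (fun i => W (e i)) ∂(Measure.pi fun _ : ι => μ) =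
      ∫ W, f W ∂(Measure.pi fun _ : ι => μ) := by
  have h := measurePreserving_comp_equiv μ e
  rw [← h.map_eq, integral_map h.measurable.aemeasurable hf.aestronglyMeasurable, h.map_eq]

end PiSymmetry

end Summit.QuantumFields.YangMills.Cruxes.IR.BetaSlopeFloor

end
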